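import Summits.Ventures.HSemireg.MethodInstanceG6ExtremalFactors
import Summits.Ventures.HSemireg.StructureLadderG2n
import HarnessLib

/-!
# Venture HSemireg — the g = 6 certificate FORCES extremal factors: the rank door's clause `dim Ext²(F₁ ⊠ F₂) ≤ R₂(n)` together with
# the per-factor inequalities `e_i ≥ r_i(n)` pins BOTH factor profiles to `(1, 2n, n(n−1))` (the cell's BOX-PRODUCT LEMMA, numeric core)

HONEST FRAMING. Lean index of the computation cell `pub-hsemireg` (seat p8, «Sunday typer § g = 6»; companion of
`MethodInstanceG6ExtremalFactors.lean`). ARITHMETIC on the real carriers only: no variety, sheaf, `Ext` group or semiregularity map is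
constructed; every geometric input is a hypothesis BY VALUE. Nothing here says HC, HC_CM or HC_AV is proved; nothing about the verdict's
deciding (non-split) rows («NO-in-families-tried», candidates 0) is touched.

WHAT IS TYPED. The predecessor file proved the FORWARD direction in the only form the tree carries: two factors IN THE WINDOW
(`e_i ≤ r_i(n) = transversePairRank n i`, `(1, 2n, n(n−1))` for `n ≥ 3`) + Künneth BY VALUE ⟹ `dim Ext²(F₁ ⊠ F₂) ≤ R₂(n) = boxRank n 2`, the rank
door's clause (with EQUALITY for EXTREMAL factors, STRUCTURE (S2)). This file proves the CONVERSE at the factor level: if each factor satisfies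
the (S1) inequality `e_i ≥ r_i(n)`
(`δ ≥ 0` degree by degree — ON PAPER from the bridge `σ ∘ ev = ⌟ch` restricted to the factor: `rank ev_i ≥ rank(⌟ch(F) ∣ HT^i) = r_i(n)`,
th-7 THEOREM T / seat p10's `transversePairRank`; BY VALUE here) and the box meets the rank door's admissibility clause
`dim Ext²(F₁ ⊠ F₂) ≤ r(P, ch E) = R₂(n)` (Künneth BY VALUE), then BOTH factors are EXTREMAL in degrees `≤ 2`: `e = (r₀, r₁, r₂)(n)`. At
`n = 3`: «each factor needs `(e₀, e₁, e₂) = (1, 6, 6)`» — the cell's BOX-PRODUCT LEMMA («each factor needs `e₁ ≤ 6` at `n = 3`: why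
Markman's non-equivariant `I_{∪Cᵢ}(Θ)` with `Ext¹ ⊋ HT¹` needs the `G`-door, and why adding points to a skeleton is fatal»,
`step0/UNTWIST-p1.md` §5d, `step0/THETA-SECANT-p1.md` §2 (S1)–(S2); [Markman2025SecantWeil] §1.4 «The sheaf E in the theorem is not
semiregular»). So, for the rank-door route, EXTREMAL FACTORS are not only sufficient (predecessor file) but NECESSARY — the g = 6 method
instances (theta-secant D-2…D-6, triangle C13-8: factor cells `(1, 6, 6, 1)`) sit exactly on the boundary «48 = 48».

* §1 the ℕ-arithmetic: products and the three-term Künneth sum under lower bounds (`prod_eq_of_ge_of_le`, `extremal_of_kunneth_sum_le`).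
* §2 the cell's currency: `r₀(n) = 1`, `r₁(n), r₂(n) > 0` for `n ≥ 2`, and `boxRank n 2 = r₀r₂ + r₁r₁ + r₂r₀`.
* §3 on the real carriers (`extRank`): `extremal_of_kunneth_of_rankClause` — factor `Ext`-dimensions BY VALUE as naturals, (S1) lower bounds
  BY VALUE, Künneth BY VALUE, the clause `rank Ext²(G,G) ≤ boxRank n 2` ⟹ both profiles `= (r₀, r₁, r₂)(n)`; `n = 3` numerals.
* §4 complement to the predecessor's §5 (theta shape): seat p11's POINT-PAIR ∕ UNTWIST shape at every level `N ≥ 2`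
  (`ladder_of_reach_of_perfectComplexRankTransfer_of_extremalBox`, `StructureLadderG2n.lean` — class side `boxRank N 2` kernel-evaluated)
  FED from two factor windows + Künneth: `ladder_of_reach_of_perfectComplexRankTransfer_of_pointPairBox_factorWindow` — no numeral left.
0 `def`, 0 `sorry`, 0 named fact. Sources: [Markman2025SecantWeil] §8.4 (arXiv v2 p. 63, Künneth decomposition between (8.4.1) and (8.4.2)),
§1.4 (preprint); [BuchweitzFlenner2008HH] Prop. 6.4.4 (the bridge, on paper); cell files as named; STRUCTURE.md v1.0-SIGNED §2 (S1)/(S2).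
-/

noncomputable section

open CategoryTheory AlgebraicGeometry Finset
open ExteriorAlgebra (ι)
open Literature.AlgebraicGeometry.Motives Literature.AlgebraicGeometry.HodgeTheory
open Literature.AlgebraicGeometry.ModuliOfAbelianVarieties Literature.AlgebraicGeometry.Deligne1982
open Literature.AlgebraicGeometry.KTheory
open Literature.AlgebraicTopology.SingularHomology

namespace Summit.Ventures.HSemireg

open FormulaN (transversePairRank)
open FormulaN.Uniform (boxRank)

/-! ## §1 The arithmetic: lower bounds + an upper bound on the Künneth sum pin every term -/

/-- Two naturals bounded below by POSITIVE `a₀, b₀` whose product does not exceed `a₀·b₀` are `a₀, b₀`. [bookkeeping] -/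
theorem prod_eq_of_ge_of_le {a b a₀ b₀ : ℕ} (ha : a₀ ≤ a) (hb : b₀ ≤ b) (ha₀ : 0 < a₀) (hb₀ : 0 < b₀) (h : a * b ≤ a₀ * b₀) :
    a = a₀ ∧ b = b₀ := by
  have hab : a₀ * b ≤ a * b := Nat.mul_le_mul_right b ha
  have hab' : a * b₀ ≤ a * b := Nat.mul_le_mul_left a hb
  refine ⟨le_antisymm ?_ ha, le_antisymm ?_ hb⟩
  · by_contra hlt
    have h1 : (a₀ + 1) * b₀ ≤ a * b₀ := Nat.mul_le_mul_right b₀ (by omega)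
    nlinarith
  · by_contra hlt
    have h1 : a₀ * (b₀ + 1) ≤ a₀ * b := Nat.mul_le_mul_left a₀ (by omega)
    nlinarith

/-- **The three-term Künneth sum under the (S1) lower bounds**: `e_i ≥ r_i`, `e'_j ≥ r_j` (`i, j ≤ 2`), `r₀, r₁, r₂ > 0`, and
`e₀e'₂ + e₁e'₁ + e₂e'₀ ≤ r₀r₂ + r₁r₁ + r₂r₀` force `e = e' = r` in degrees `≤ 2`. [bookkeeping] -/
theorem extremal_of_kunneth_sum_le {e₀ e₁ e₂ e₀' e₁' e₂' r₀ r₁ r₂ : ℕ} (h₀ : r₀ ≤ e₀) (h₁ : r₁ ≤ e₁) (h₂ : r₂ ≤ e₂)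
    (h₀' : r₀ ≤ e₀') (h₁' : r₁ ≤ e₁') (h₂' : r₂ ≤ e₂') (hr₀ : 0 < r₀) (hr₁ : 0 < r₁) (hr₂ : 0 < r₂)
    (h : e₀ * e₂' + e₁ * e₁' + e₂ * e₀' ≤ r₀ * r₂ + r₁ * r₁ + r₂ * r₀) :
    (e₀ = r₀ ∧ e₁ = r₁ ∧ e₂ = r₂) ∧ (e₀' = r₀ ∧ e₁' = r₁ ∧ e₂' = r₂) := by
  have t₁ : r₀ * r₂ ≤ e₀ * e₂' := Nat.mul_le_mul h₀ h₂'
  have t₂ : r₁ * r₁ ≤ e₁ * e₁' := Nat.mul_le_mul h₁ h₁'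
  have t₃ : r₂ * r₀ ≤ e₂ * e₀' := Nat.mul_le_mul h₂ h₀'
  have u₁ := prod_eq_of_ge_of_le h₀ h₂' hr₀ hr₂ (by omega)
  have u₂ := prod_eq_of_ge_of_le h₁ h₁' hr₁ hr₁ (by omega)
  have u₃ := prod_eq_of_ge_of_le h₂ h₀' hr₂ hr₀ (by omega)
  exact ⟨⟨u₁.1, u₂.1, u₃.1⟩, ⟨u₃.2, u₂.2, u₁.2⟩⟩

/-! ## §2 The cell's currency: `(r₀, r₁, r₂)(n)` is positive for `n ≥ 2`, and `R₂(n) = r₀r₂ + r₁² + r₂r₀` -/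

/-- `r₀(n) = 1` for `n ≥ 1` (a K-secant factor is simple: `rank(⌟ch(F) ∣ HT⁰) = 1`). [bookkeeping] -/
theorem transversePairRank_zero_eq_one {n : ℕ} (hn : 0 < n) : transversePairRank n 0 = 1 := by
  unfold transversePairRank
  simp only [Nat.choose_zero_right, if_true, show (0 : ℕ) ≠ n by omega, if_false]

/-- `r₁(n) = 2n` for `n ≥ 2` (STRUCTURE (S2): `e₁ = 2n` for an extremal factor). [bookkeeping] -/
theorem transversePairRank_one_eq {n : ℕ} (hn : 2 ≤ n) : transversePairRank n 1 = 2 * n := by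
  unfold transversePairRank
  simp only [Nat.choose_one_right, show (1 : ℕ) ≠ 0 by omega, show (1 : ℕ) ≠ n by omega, if_false, Nat.sub_zero]

/-- `r₂(n) ≥ 1` for `n ≥ 2` (`= n(n−1)` for `n ≥ 3`, `= 1` at `n = 2`). [bookkeeping] -/
theorem transversePairRank_two_pos {n : ℕ} (hn : 2 ≤ n) : 0 < transversePairRank n 2 := by
  unfold transversePairRank
  have h2 : 1 ≤ n.choose 2 := Nat.choose_pos hn
  rw [if_neg (show (2 : ℕ) ≠ 0 by omega)]
  by_cases h : 2 = n
  · rw [if_pos h]; omega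
  · rw [if_neg h]; omega

/-- `R₂(n) = boxRank n 2 = r₀r₂ + r₁r₁ + r₂r₀` — seat p10's Cauchy-product definition, unfolded in degree `2`. [bookkeeping] -/
theorem boxRank_two_eq_sum (n : ℕ) : boxRank n 2 = transversePairRank n 0 * transversePairRank n 2 +
    transversePairRank n 1 * transversePairRank n 1 + transversePairRank n 2 * transversePairRank n 0 := by
  simp only [boxRank, Finset.Nat.sum_antidiagonal_succ, Finset.Nat.antidiagonal_zero, Finset.sum_singleton]
  ring

/-! ## §3 On the real carriers: the rank door's clause forces EXTREMAL factors -/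

section Carriers

variable {Y₀ Y₁ Y₂ : SchemeOver ℂ}

/-- **THE CERTIFICATE FORCES EXTREMAL FACTORS** (converse of `extRank_le_boxRank_of_kunneth_of_window` ∕ `…_of_extremal` in degree `2`; the cell's
BOX-PRODUCT LEMMA, numeric core). Three objects `G` (on `Y₀`; for the cell the box `F₁ ⊠ F₂`), `F₁`, `F₂`, with, BY VALUE: finite `Ext`-dimensions
`e i = dim Extⁱ(F₁,F₁)`, `e' j = dim Extʲ(F₂,F₂)` for `i, j ≤ 2` (`hE`, `hE'`); the (S1) LOWER BOUNDS `e i ≥ r_i(n)`, `e' j ≥ r_j(n)` (`hlow`,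
`hlow'` — `δ ≥ 0` degree by degree, on paper from the bridge restricted to each factor); the KÜNNETH identity in degree `2` (`hK`); and the
rank door's ADMISSIBILITY CLAUSE with the class side evaluated, `rank Ext²(G,G) ≤ R₂(n) = boxRank n 2` (`h2`; `n ≥ 2`). THEN both factors
are EXTREMAL in degrees `≤ 2`: `e = e' = (r₀, r₁, r₂)(n)` (`= (1, 2n, n(n−1))` for `n ≥ 3`), and the clause holds with equality. So on the
rank-door route extremal factors are NECESSARY, not only sufficient: a factor with `e₁ > 2n` (Markman's non-equivariant `I_{∪Cᵢ}(Θ)`, whose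
`Ext¹` strictly contains `HT¹`) or with `e₂ > n(n−1)` (skeleta with added points) can never pass «`dim Ext² ≤ r`» in a box.
[cite: Markman2025SecantWeil, §8.4 (Künneth decomposition, arXiv v2 p. 63) and §1.4 «The sheaf E in the theorem is not semiregular» (preprint)]
[cite: BuchweitzFlenner2008HH, Prop. 6.4.4] -/
theorem extremal_of_kunneth_of_rankClause (G : CochainComplex Y₀.left.Modules ℤ)
    (F₁ : CochainComplex Y₁.left.Modules ℤ) (F₂ : CochainComplex Y₂.left.Modules ℤ) {n : ℕ} (hn : 2 ≤ n) (e e' : ℕ → ℕ)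
    (hE : ∀ i : ℕ, i ≤ 2 → extRank Y₁ F₁ i = e i) (hE' : ∀ j : ℕ, j ≤ 2 → extRank Y₂ F₂ j = e' j)
    (hlow : ∀ i : ℕ, i ≤ 2 → transversePairRank n i ≤ e i) (hlow' : ∀ j : ℕ, j ≤ 2 → transversePairRank n j ≤ e' j)
    (hK : extRank Y₀ G (2 : ℕ) = ∑ ij ∈ antidiagonal (2 : ℕ), extRank Y₁ F₁ ij.1 * extRank Y₂ F₂ ij.2)
    (h2 : extRank Y₀ G 2 ≤ ((boxRank n 2 : ℕ) : Cardinal)) :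
    (∀ i : ℕ, i ≤ 2 → e i = transversePairRank n i ∧ e' i = transversePairRank n i) ∧
      extRank Y₀ G 2 = ((boxRank n 2 : ℕ) : Cardinal) := by
  -- the Künneth sum in naturals
  have hsum : extRank Y₀ G (2 : ℕ) = ((e 0 * e' 2 + e 1 * e' 1 + e 2 * e' 0 : ℕ) : Cardinal) := by
    rw [hK]
    simp only [Finset.Nat.sum_antidiagonal_succ, Finset.Nat.antidiagonal_zero, Finset.sum_singleton]
    rw [hE 0 (by norm_num), hE 1 (by norm_num), hE 2 le_rfl, hE' 0 (by norm_num), hE' 1 (by norm_num), hE' 2 le_rfl]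
    push_cast
    ring
  have hle : e 0 * e' 2 + e 1 * e' 1 + e 2 * e' 0 ≤ boxRank n 2 := by
    have h2' := h2
    rw [show ((2 : ℕ) : ℤ) = 2 from rfl] at hsum
    rw [hsum] at h2'
    exact_mod_cast h2'
  rw [boxRank_two_eq_sum] at hle
  have hr₀ : 0 < transversePairRank n 0 := by rw [transversePairRank_zero_eq_one (by omega)]; exact Nat.one_pos
  have hr₁ : 0 < transversePairRank n 1 := by rw [transversePairRank_one_eq hn]; omega
  obtain ⟨⟨a0, a1, a2⟩, ⟨b0, b1, b2⟩⟩ := extremal_of_kunneth_sum_le (hlow 0 (by norm_num)) (hlow 1 (by norm_num)) (hlow 2 le_rfl)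
    (hlow' 0 (by norm_num)) (hlow' 1 (by norm_num)) (hlow' 2 le_rfl) hr₀ hr₁ (transversePairRank_two_pos hn) hle
  refine ⟨fun i hi ↦ ?_, ?_⟩
  · interval_cases i
    · exact ⟨a0, b0⟩
    · exact ⟨a1, b1⟩
    · exact ⟨a2, b2⟩
  · rw [show (2 : ℤ) = ((2 : ℕ) : ℤ) from rfl, hsum, a0, a1, a2, b0, b1, b2, boxRank_two_eq_sum]

/-- **At `n = 3` (g = 6): each factor of a box passing the rank door's clause «`dim Ext² ≤ 48`» has `(e₀, e₁, e₂) = (1, 6, 6)`** — the theta-secant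
factor `𝓕_m` and the triangle sheaf `F_△` sit exactly on this boundary (census cells `(1, 6, 6, 1)`); a factor with `e₁ ≥ 7` or `e₂ ≥ 7` cannot.
[cite: Markman2025SecantWeil, §8.4 and §1.4 (preprint)] -/
theorem extremal_three_of_kunneth_of_rankClause (G : CochainComplex Y₀.left.Modules ℤ)
    (F₁ : CochainComplex Y₁.left.Modules ℤ) (F₂ : CochainComplex Y₂.left.Modules ℤ) (e e' : ℕ → ℕ)
    (hE : ∀ i : ℕ, i ≤ 2 → extRank Y₁ F₁ i = e i) (hE' : ∀ j : ℕ, j ≤ 2 → extRank Y₂ F₂ j = e' j)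
    (hlow : ∀ i : ℕ, i ≤ 2 → transversePairRank 3 i ≤ e i) (hlow' : ∀ j : ℕ, j ≤ 2 → transversePairRank 3 j ≤ e' j)
    (hK : extRank Y₀ G (2 : ℕ) = ∑ ij ∈ antidiagonal (2 : ℕ), extRank Y₁ F₁ ij.1 * extRank Y₂ F₂ ij.2)
    (h2 : extRank Y₀ G 2 ≤ 48) :
    (e 0 = 1 ∧ e 1 = 6 ∧ e 2 = 6) ∧ (e' 0 = 1 ∧ e' 1 = 6 ∧ e' 2 = 6) ∧ extRank Y₀ G 2 = 48 := by
  have h48 : ((boxRank 3 2 : ℕ) : Cardinal) = 48 := by rw [kunneth_three_two.2.2]; norm_cast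
  have h := extremal_of_kunneth_of_rankClause G F₁ F₂ (n := 3) (by norm_num) e e' hE hE' hlow hlow' hK (h48 ▸ h2)
  have r0 : transversePairRank 3 0 = 1 := by decide
  have r1 : transversePairRank 3 1 = 6 := by decide
  have r2 : transversePairRank 3 2 = 6 := by decide
  refine ⟨⟨r0 ▸ (h.1 0 (by norm_num)).1, r1 ▸ (h.1 1 (by norm_num)).1, r2 ▸ (h.1 2 le_rfl).1⟩,
    ⟨r0 ▸ (h.1 0 (by norm_num)).2, r1 ▸ (h.1 1 (by norm_num)).2, r2 ▸ (h.1 2 le_rfl).2⟩, h48 ▸ h.2⟩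

end Carriers


/-! ## §4 Complement: seat p11's point-pair shape at every level `N ≥ 2`, fed from two factor windows -/

section PointPair

open Summit.HodgeConjecture.HodgeConjecture
open Summit.HodgeConjecture.HodgeConjecture.WeilTypeLadder
open Summit.HodgeConjecture.HodgeConjecture.Cruxes.HodgeAbelianVarieties.EStepSecantInduction
open Summit.Ventures.HSemireg.GeneralStructure

variable {C : ChernCharacterBetti}
variable {Y₀ Y₁ Y₂ : SchemeOver ℂ}
variable {V₁ V₂ : Type} [AddCommGroup V₁] [Module ℂ V₁] [AddCommGroup V₂] [Module ℂ V₂] [FiniteDimensional ℂ V₂]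
variable {kV : ℕ} (b₂ : Module.Basis (Fin kV) ℂ V₂) (L₁ : Submodule ℂ V₁) (L₂ : Submodule ℂ V₂)
variable {Asrc : AbelianVariety ℂ} {W₁ W₂ M₁ M₂ : Submodule ℂ (complexBetti Asrc.X 1)}

/-- **THE POINT-PAIR ∕ UNTWIST MECHANISM (g = 4 anchor `E₀ = Φ(I_p ⊠ I_q)`, STEP-0) IS UNIFORM IN `N ≥ 2` WITH NO NUMERAL HYPOTHESIS**: seat
p11's `ladder_of_reach_of_perfectComplexRankTransfer_of_extremalBox` (class side `r(P, ch E) = boxRank N 2` EVALUATED in the kernel from the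
point-pair box SHAPE `(a₁ + b₁ω₁)(a₂ + b₂ω₂)` transported along the partial Fourier transform and twisted; its object-side clause
`dim Ext²(G,G) ≤ boxRank N 2` BY VALUE) with that clause PRODUCED from two FACTOR WINDOWS `≤ (r₀, r₁, r₂)(N)` + Künneth (predecessor §1).
At `N = 2`: factors `I_p`, `I_q` on an abelian SURFACE, windows `(1, 4, 1)` (`Hom = ℂ`, `Ext¹ = H¹(𝒪) ⊕ T_p`, `Ext² = ℂ` by Serre duality),
`1 + 16 + 1 = 18 = dim Ext²(E₀,E₀)` — the census's g = 4 anchor (VERDICT V-4: g = 4 YES as method instances). BY NAME: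
`weilFamilyReach_hyperbolic`, `PerfectComplexRankTransfer C`; everything else BY VALUE (frame binders as in seat p11's theorem). Conclusion:
`Stubs.WeilAlgebraicSplitHyperplane N d ∧ ∀ n, 2 ≤ n < N → WeilAlgebraicAll n d`. Existence of such factor pairs at a level is STRUCTURE (S4)
— not asserted. [cite: Markman2025SecantWeil, Thm. 1.5.1, Cor. 1.6.1, Lemma 8.3.4 and §8.4 (preprint)] [cite: BuchweitzFlenner2008HH, Prop. 6.4.4]
[cite: Mukai1981, Thm. 2.2] [cite: Deligne1982HodgeCycles, proof of Thm. 4.8] -/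
theorem ladder_of_reach_of_perfectComplexRankTransfer_of_pointPairBox_factorWindow
    (hF' : weilFamilyReach_hyperbolic) (hT : PerfectComplexRankTransfer C) {N d : ℕ} (hN : 2 ≤ N) (hd : 0 < d)
    (P : AbelianVariety ℂ) (ψ₀ : P ⟶ P) (e : ProjectiveEmbedding P.X) (a : complexBetti (projectiveSpace e.n ℂ) 2)
    (hP : P.dim = 2 * N) (hψ : ψ₀ ≫ ψ₀ = -(d • 𝟙 P)) (ha : IsRationalClass a) (ha0 : a ≠ 0)
    (hhyp : IsHyperbolicWeilType P ψ₀ N (symmetrisedClass d P ψ₀ e a))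
    (w : complexBetti P.X (2 * N)) (hwW : w ∈ weilClassesOf P ψ₀ N d) (hwr : IsRationalClass w) (hw0 : w ≠ 0)
    (I : Finset ℕ) (hI : ∀ p : ℕ, 1 ≤ p → p ≤ 2 * N → p ∈ I) (E : CochainComplex P.X.left.Modules ℤ)
    (hE : IsBoundedVBComplex E) (q : ℚ) (cq : ℕ → ℚ)
    (hchN : chPerfect C P.X E hE.isFiniteLocallyFree N = ((q : ℚ) : ℂ) • cupPowTwo (symmetrisedClass d P ψ₀ e a) N + w)
    (hchp : ∀ p ∈ I, p ≠ N →
      chPerfect C P.X E hE.isFiniteLocallyFree p = ((cq p : ℚ) : ℂ) • cupPowTwo (symmetrisedClass d P ψ₀ e a) p)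
    -- object side: source box, transport, `Hom = ℂ`, two FACTORS in the window, Künneth (BY VALUE)
    (G : CochainComplex Y₀.left.Modules ℤ) (hext : ∀ m : ℤ, m ≤ 2 → extRank P.X E m = extRank Y₀ G m)
    (hneg : ∀ m : ℤ, m < 0 → extRank Y₀ G m = 0) (h0 : extRank Y₀ G 0 = 1)
    (F₁ : CochainComplex Y₁.left.Modules ℤ) (F₂ : CochainComplex Y₂.left.Modules ℤ)
    (hK : extRank Y₀ G (2 : ℕ) = ∑ ij ∈ antidiagonal (2 : ℕ), extRank Y₁ F₁ ij.1 * extRank Y₂ F₂ ij.2)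
    (hF₁ : ∀ i : ℕ, i ≤ 2 → extRank Y₁ F₁ i ≤ transversePairRank N i)
    (hF₂ : ∀ j : ℕ, j ≤ 2 → extRank Y₂ F₂ j ≤ transversePairRank N j)
    -- class side: seat p11's point-pair box SHAPE on the source frame, its partial Fourier transport, the twist (BY VALUE)
    (hAsrc : IsSmoothProjective Asrc.dim Asrc.X) (κs : ∀ p : ℕ, complexBetti Asrc.X (2 * p))
    (hW : IsCompl W₁ W₂) (hW₁ : Module.finrank ℂ W₁ = 2 * N) (hW₂ : Module.finrank ℂ W₂ = 2 * N)
    (hM : hodgeZeroOne hAsrc = M₁ ⊔ M₂) (hM₁ : M₁ ≤ W₁) (hM₂ : M₂ ≤ W₂)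
    (hm₁ : Module.finrank ℂ M₁ = N) (hm₂ : Module.finrank ℂ M₂ = N)
    {ω₁ : ExteriorAlgebra ℂ W₁} (hω₁ : ω₁ ∈ ⋀[ℂ]^(2 * N) W₁) (hω₁0 : ω₁ ≠ 0)
    {ω₂ : ExteriorAlgebra ℂ W₂} (hω₂ : ω₂ ∈ ⋀[ℂ]^(2 * N) W₂) (hω₂0 : ω₂ ≠ 0)
    {a₁ b₁ a₂ b₂' : ℂ} (ha₁ : a₁ ≠ 0) (hb₁ : b₁ ≠ 0) (ha₂ : a₂ ≠ 0) (hb₂ : b₂' ≠ 0)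
    (hbox : totalExteriorClass Asrc κs =
      ExteriorAlgebra.map W₁.subtype (algebraMap ℂ _ a₁ + b₁ • ω₁) * ExteriorAlgebra.map W₂.subtype (algebraMap ℂ _ a₂ + b₂' • ω₂))
    (κ₀ : ∀ p : ℕ, complexBetti P.X (2 * p))
    (g : complexBetti Asrc.X 1 ≃ₗ[ℂ] V₁ × V₂) (g' : complexBetti P.X 1 ≃ₗ[ℂ] V₁ × Module.Dual ℂ V₂)
    (hL : ⇑g '' hodgeZeroOneSet Asrc = (L₁.prod L₂ : Set (V₁ × V₂)))
    (hL' : ⇑g' '' hodgeZeroOneSet P = (L₁.prod L₂.dualAnnihilator : Set (V₁ × Module.Dual ℂ V₂)))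
    (hF : ExteriorAlgebra.map g'.toLinearMap (totalExteriorClass P κ₀) =
      ContractionSpan.partialFourier b₂ (ExteriorAlgebra.map g.toLinearMap (totalExteriorClass Asrc κs)))
    {c : ExteriorAlgebra ℂ (complexBetti P.X 1)}
    (hc : c ∈ Submodule.span ℂ {z : ExteriorAlgebra ℂ (complexBetti P.X 1) |
      ∃ v : complexBetti P.X 1, ∃ q ∈ hodgeZeroOneSet P, z = ι ℂ v * ι ℂ q}) {Nc : ℕ} (hNc : c ^ Nc = 0)
    (htw : totalExteriorClass P (fun p ↦ chPerfect C P.X E hE.isFiniteLocallyFree p) =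
      totalExteriorClass P κ₀ * ∑ k ∈ Finset.range Nc, ((k.factorial : ℂ)⁻¹) • c ^ k) :
    Stubs.WeilAlgebraicSplitHyperplane N d ∧ ∀ n : ℕ, 2 ≤ n → n < N → WeilAlgebraicAll n d :=
  ladder_of_reach_of_perfectComplexRankTransfer_of_extremalBox b₂ L₁ L₂ hF' hT hN hd P ψ₀ e a hP hψ ha ha0 hhyp w hwW hwr hw0 I hI E hE
    q cq hchN hchp G hext hneg h0 (extRank_le_boxRank_of_kunneth_of_window G F₁ F₂ (n := N) (k := 2) hK hF₁ hF₂) hAsrc κs hW hW₁ hW₂ hM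
    hM₁ hM₂ hm₁ hm₂ hω₁ hω₁0 hω₂ hω₂0 ha₁ hb₁ ha₂ hb₂ hbox κ₀ g g' hL hL' hF hc hNc htw

end PointPair

/-! ## Audit: nothing is decided here
KERNEL: ℕ-arithmetic (§1–§2), its transcription to `extRank` (§3), one composition with seat p11's landed theorem (§4). BY VALUE: the factor
`Ext`-dimensions ∕ windows, the (S1) lower bounds, the Künneth identity, the rank door's clause, §4's frame binders. BY NAME (§4 only):
`weilFamilyReach_hyperbolic`, `PerfectComplexRankTransfer C`. No new named fact. Not here: any sheaf, any `σ`, any non-split component,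
HC_CM, CM density. -/

end Summit.Ventures.HSemireg

end
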